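import Literature.AnabelianGeometry.AbsoluteAnabelian.HyperbolicCoverOfNonabelianFundamentalGroup
import Literature.Topology.CoveringSpaces.UniversalCoverSecondCountable
import HarnessLib

/-!
# A second countable Riemann surface with non-abelian fundamental group is covered by the disc

PROOF-ONLY closer (abc-iut cell, campaign-L programme «UNIF» Tier 2, seat abc-iut-w6-d031): the consumer
`exists_disc_covering_of_nonabelian_fundamentalGroup` (abc-iut-L4-t8,
`HyperbolicCoverOfNonabelianFundamentalGroup.lean`) of the Poincaré–Koebe named fact
`RiemannSurface.SimplyConnectedUniformization` is stated under the binder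
`[SecondCountableTopology (UniversalCover X x₀)]`.  That binder is DISCHARGED here from
`[SecondCountableTopology X]`: the fundamental group of a second countable manifold is countable and the
universal cover has countable fibres, hence is second countable (J. M. Lee, *Introduction to Topological
Manifolds* (2011), Thm. 7.21; the tree's `UniversalCover.secondCountableTopology`,
`UniversalCoverSecondCountable.lean`), the hypotheses «path connected, strongly locally contractible»
holding for every connected Riemann surface (`RiemannSurfaceUniversalCover.lean`).

* `Literature.Geometry.Kaehler.UniversalCover.secondCountableTopology_riemannSurface` — the universal
  cover of a connected second countable Riemann surface is second countable;
* `exists_disc_covering_of_nonabelian_fundamentalGroup'` — I-Hsiung Lin, *Classical Complex Analysis*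
  vol. 2 (2011), §7.6.2 (7.6.2.1) case (3): a connected, Hausdorff, SECOND COUNTABLE Riemann surface whose
  fundamental group is non-abelian admits a surjective holomorphic covering by the unit disc —
  conditional ONLY on the named fact `SimplyConnectedUniformization`.

Classical; nothing here bears on [IUTchIII] Cor. 3.12.
-/

noncomputable section

open Set Function TopologicalSpace
open scoped Manifold ContDiff Topology

namespace Literature.AnabelianGeometry.AbsoluteAnabelian

open Literature.Topology.CoveringSpaces Literature.Geometry.Kaehler

variable {X : Type} [TopologicalSpace X]

/-- **The universal cover of a connected second countable Riemann surface is second countable**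
(countable `π₁`, Lee Thm. 7.21, and countable fibres; the topological hypotheses of
`UniversalCover.secondCountableTopology` hold for a connected space charted over `ℂ`).
[cite: Lee2011TopologicalManifolds, Thm. 7.21] -/
theorem _root_.Literature.Geometry.Kaehler.UniversalCover.secondCountableTopology_riemannSurface
    [SecondCountableTopology X] [ConnectedSpace X] [ChartedSpace ℂ X] (x₀ : X) :
    SecondCountableTopology (UniversalCover X x₀) := by
  haveI := pathConnectedSpace_of_connectedSpace X
  haveI := stronglyLocallyContractibleSpace_of_riemannSurface X
  exact UniversalCover.secondCountableTopology

/-- **A connected second countable Riemann surface with non-abelian fundamental group is holomorphically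
covered by the unit disc** (Lin (7.6.2.1), case (3) of the trichotomy by universal covering surface),
conditional only on the uniformization of simply connected Riemann surfaces `H2`: the binder
`[SecondCountableTopology (UniversalCover X x₀)]` of `exists_disc_covering_of_nonabelian_fundamentalGroup`
discharged from `[SecondCountableTopology X]`.
[cite: Lin2011ClassicalComplexAnalysisII, §7.6.2 (7.6.2.1)] -/
theorem exists_disc_covering_of_nonabelian_fundamentalGroup'
    (H2 : Literature.Geometry.Kaehler.RiemannSurface.SimplyConnectedUniformization)
    [T2Space X] [SecondCountableTopology X] [ConnectedSpace X] [ChartedSpace ℂ X]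
    [IsManifold 𝓘(ℂ, ℂ) ω X] (x₀ : X) (hπ : ∃ a b : FundamentalGroup X x₀, a * b ≠ b * a) :
    ∃ p : unitDiscOpens → X,
      IsCoveringMap p ∧ Function.Surjective p ∧ MDifferentiable 𝓘(ℂ, ℂ) 𝓘(ℂ, ℂ) p := by
  haveI := Literature.Geometry.Kaehler.UniversalCover.secondCountableTopology_riemannSurface x₀
  exact exists_disc_covering_of_nonabelian_fundamentalGroup H2 x₀ hπ

end Literature.AnabelianGeometry.AbsoluteAnabelian

end
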